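import Summits.HodgeConjecture.CorCM.GaloisLeftStabiliserInducedType
import Summits.HodgeConjecture.CorCM.CyclicCMTypesClassification
import Literature.AlgebraicGeometry.ComplexMultiplication.EndomorphismFieldNondegenerateType
import Literature.NumberTheory.ComplexMultiplication.ShimuraTaniyamaHecke
import HarnessLib

/-!
# CM fields with CYCLIC Galois group of order `2^{a+1} m`, `m ∈ {1} ∪ primes`: EVERY abelian variety with complex
# multiplication by the field is STABLY NONDEGENERATE — and the classification for all abelian varieties

COR-CM (cell `pub-hodgecm2`), binder seat b04 (gen 21), count-neutral claim CYCLIC-ALLTYPES (the cyclic companion of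
DICYCLIC-ALLTYPES, `CorCM/GaloisDicyclicAllTypes`).  KERNEL ONLY: theorems; no definition, no named fact, no `sorry`.
`HC_CM` is neither used nor claimed: this is the Hodge conjecture for a NAMED CLASS of abelian varieties, UNCONDITIONALLY.

Gens 11–12 (`CyclicTwoPowerCMTypes`, `CyclicTimesPrimeCMTypes(.Field)`, `CyclicCMTypesClassification`): for a CM field
`K`, Galois over `ℚ` with CYCLIC group of order `[K:ℚ] = 2^{a+1} m` (`m` odd), every PRIMITIVE CM type is nondegenerate
iff `m = 1` or `m` is prime; so for such `m` every SIMPLE abelian variety with CM by `K` satisfies the Hodge conjecture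
with all its powers.  Here the simplicity hypothesis is REMOVED: an IMPRIMITIVE type `Φ` has a left stabiliser `v ≠ 1`
in `Gal(K/ℚ)` (gen 20 part XIII), `⟨v⟩` avoids complex conjugation `c` (it stabilises the CM set), hence has ODD order
(`c` is the unique involution of the cyclic group) — so `|⟨v⟩| = m` — and `Φ` is INDUCED from the fixed field
`K₀ = K^{⟨v⟩}` (part I `exists_inducedCMType_fixedField_of_leftStabiliser`), a CM field, Galois with CYCLIC group of
order `2^{a+1}`, ALL of whose CM types are nondegenerate (gen 11 `isNondegenerate_of_isCyclic`); Shimura's `X ∼ B^m`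
(lit-hodgefound's junction `EndFieldFullDegree.isStablyNondegenerate_of_isNondegenerate`) finishes.

* §1 `odd_card_subgroup_of_not_mem` — in a finite cyclic group a subgroup avoiding the involution `c` has odd order.
* §2 **`isNondegenerate_or_exists_induced_of_isCyclic`** — `m` prime: every CM type of `K` is nondegenerate or induced
  from a NONDEGENERATE type of the cyclic CM subfield `K₀` of degree `2^{a+1}`.
* §3 **`isStablyNondegenerate_of_ringHom_of_isCyclic`** — `m = 1` or `m` prime: EVERY complex abelian variety `X` with
  `φ : K →+* End⁰(X)`, `[K:ℚ] = 2 dim X`, is stably nondegenerate; HC for all powers and everything isogenous to a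
  power; realisation forms (`hodgeConjectureFor_pow_of_isCyclic_all`); **THE CLASSIFICATION
  `forall_isStablyNondegenerate_iff_of_isCyclic`**: all such `X` stably nondegenerate ⟺ `m = 1 ∨ m` prime.
* §4 `ℚ(ζ_p)`, `p − 1 = 2^{a+1} m` with `m ∈ {1} ∪ primes` (`p = 5, 7, 11, 13, 17, 23, 29, 41, 47, 53, 59, 83, 89, 97,
  107, …`): every abelian variety of dimension `(p−1)/2` with `ℚ(ζ_p) ↪ End⁰` is stably nondegenerate
  (`isStablyNondegenerate_of_ringHom_cyclotomic`), and the classification by `m` (`…_iff_cyclotomic`).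

## References

* [Shimura1998] G. Shimura, *Abelian Varieties with Complex Multiplication and Modular Functions* (1998), §5.1 Prop. 3,
  §6.2 Thm. 3, §8.2 Prop. 26.
* [Gordon1999HodgeAVSurvey] B. B. Gordon, *A survey of the Hodge conjecture for abelian varieties*, Thm. 6.4, Def. 7.6,
  Prop. 9.4.1–9.4.2.
* [Kubota1965] T. Kubota, Trans. AMS 118 (1965), §4 Lemma 2.
* [Dodson1984] B. Dodson, *The structure of Galois groups of CM-fields*, Trans. AMS 283 (1984), §3.2.1.
* [Washington1997] L. C. Washington, *Introduction to Cyclotomic Fields*, Thm. 2.5.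
-/

noncomputable section

open CategoryTheory CategoryTheory.Limits NumberField

namespace Summit.HodgeConjecture.CorCM.CyclicAllTypes

open Literature.NumberTheory.ComplexMultiplication
open Literature.AlgebraicGeometry Literature.AlgebraicGeometry.Motives Literature.AlgebraicGeometry.HodgeTheory
open Literature.AlgebraicGeometry.Motives.AbelianVariety
open Literature.AlgebraicGeometry.ComplexMultiplication
open Literature.AlgebraicGeometry.Pohlmann1968
open Summit.HodgeConjecture.CorCM.GaloisRank
open Summit.HodgeConjecture.CorCM.CyclicTwoPower (involution_eq_pow isNondegenerate_of_isCyclic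
  isNondegenerate_of_isPrimitive_of_isCyclic cm_normal_cyclic_finrank_of_prime)
open Summit.HodgeConjecture.CorCM.CyclicComposite (exists_isPrimitive_not_isNondegenerate_of_isCyclic)

/-! ## §1 Subgroups of a cyclic group avoiding the involution -/

section Group

variable {G : Type*} [Group G] [Fintype G]

/-- **In a finite cyclic group, a subgroup not containing the involution `c` has ODD order** (a subgroup of even order
contains an involution, Cauchy; a cyclic group has at most one involution, gen 11 `involution_eq_pow`). [folklore] -/
theorem odd_card_subgroup_of_not_mem (hcyc : IsCyclic G) (H : Subgroup G) {c : G} (hc1 : c ≠ 1) (hcc : c * c = 1)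
    (hcH : c ∉ H) : Odd (Nat.card H) := by
  classical
  by_contra hodd
  rw [Nat.not_odd_iff_even, even_iff_two_dvd, Nat.card_eq_fintype_card] at hodd
  haveI : Fact (Nat.Prime 2) := ⟨Nat.prime_two⟩
  obtain ⟨u, hu⟩ := exists_prime_orderOf_dvd_card 2 hodd
  have hu1 : (u : G) ≠ 1 := fun h => by
    have h1 : u = 1 := Subtype.ext h
    rw [h1, orderOf_one] at hu
    exact absurd hu (by norm_num)
  have huu : (u : G) * u = 1 := by
    rw [← Subgroup.coe_mul, ← pow_two, ← hu, pow_orderOf_eq_one, Subgroup.coe_one]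
  obtain ⟨γ, hγgen⟩ := hcyc.exists_generator
  have hgen : ∀ x : G, x ∈ Submonoid.powers γ := fun x => mem_powers_iff_mem_zpowers.2 (hγgen x)
  have hc2 : orderOf c = 2 := orderOf_eq_prime (by rw [pow_two, hcc]) hc1
  obtain ⟨m, hm⟩ : 2 ∣ Fintype.card G := hc2 ▸ orderOf_dvd_card
  have hγ : orderOf γ = 2 * m := by
    rw [orderOf_eq_card_of_forall_mem_zpowers hγgen, Nat.card_eq_fintype_card, hm]
  have e1 := involution_eq_pow hγ hgen hc1 hcc
  have e2 := involution_eq_pow hγ hgen hu1 huu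
  exact hcH (by rw [e1, ← e2]; exact u.2)

/-- Hence, in a cyclic group of order `2^{a+1} m` with `m` prime, a non-trivial element `v` with `c ∉ ⟨v⟩` has order
`m`. [folklore] -/
theorem orderOf_eq_of_not_mem_zpowers (hcyc : IsCyclic G) {a m : ℕ} (hm : m.Prime) (hG : Fintype.card G = 2 ^ (a + 1) * m)
    {c v : G} (hc1 : c ≠ 1) (hcc : c * c = 1) (hcv : c ∉ Subgroup.zpowers v) (hv1 : v ≠ 1) : orderOf v = m := by
  have hodd : Odd (orderOf v) := by
    rw [← Nat.card_zpowers]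
    exact odd_card_subgroup_of_not_mem hcyc _ hc1 hcc hcv
  have h2 : ¬ 2 ∣ orderOf v := fun h => (Nat.not_even_iff_odd.2 hodd) (even_iff_two_dvd.2 h)
  have hcop : Nat.Coprime (orderOf v) (2 ^ (a + 1)) :=
    Nat.Coprime.pow_right _ ((Nat.Prime.coprime_iff_not_dvd Nat.prime_two).2 h2).symm
  have hdvd : orderOf v ∣ 2 ^ (a + 1) * m := hG ▸ orderOf_dvd_card
  rcases (Nat.dvd_prime hm).1 (hcop.dvd_of_dvd_mul_left hdvd) with h | h
  · exact absurd (orderOf_eq_one_iff.1 h) hv1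
  · exact h

end Group

/-! ## §2 Imprimitive types are induced from the cyclic CM subfield of `2`-power degree -/

section Field

variable {K : Type} [Field K] [NumberField K] [IsCMField K] [IsGalois ℚ K]

/-- **THE TYPE-LEVEL DICHOTOMY (cyclic).**  `Gal(K/ℚ)` cyclic of order `[K:ℚ] = 2^{a+1} q`, `q` an odd prime: every
CM type `Φ` of `K` is either NONDEGENERATE (when primitive, gen 11), or INDUCED from a NONDEGENERATE CM type `Φ₀` of the
CM subfield `K₀ = K^{C_q}`, Galois with cyclic group of order `2^{a+1}` (all of whose types are nondegenerate, gen 11).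
[cite: Shimura1998, §8.2 Prop. 26] [cite: Kubota1965, §4 Lemma 2] [cite: Gordon1999HodgeAVSurvey, Prop. 9.4.1] -/
theorem isNondegenerate_or_exists_induced_of_isCyclic (hcyc : IsCyclic (K ≃ₐ[ℚ] K)) {a q : ℕ} (hq : q.Prime)
    (hq2 : q ≠ 2) (hK : Module.finrank ℚ K = 2 ^ (a + 1) * q) (Φ : CMType K) :
    IsNondegenerate Φ ∨
      ∃ (K₀ : IntermediateField ℚ K) (_ : IsCMField K₀) (_ : IsGalois ℚ K₀) (Φ₀ : CMType K₀),
        inducedCMType (algebraMap K₀ K) Φ₀ = Φ ∧ IsNondegenerate Φ₀ ∧ Module.finrank ℚ K₀ = 2 ^ (a + 1) ∧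
        IsCyclic (K₀ ≃ₐ[ℚ] K₀) := by
  classical
  obtain ⟨φ₀⟩ := (inferInstance : Nonempty (K →+* ℂ))
  by_cases hprim : IsPrimitive (ℂ ≃+* ℂ) Φ.1 φ₀
  · exact Or.inl (isNondegenerate_of_isPrimitive_of_isCyclic hcyc hq hq2 hK Φ φ₀ hprim)
  · right
    set e : (K ≃ₐ[ℚ] K) ≃* (K ≃ₐ[ℚ] K) := MulEquiv.refl _ with he
    set S : Finset (K ≃ₐ[ℚ] K) := Finset.univ.filter fun y => embOf φ₀ (e.symm y) ∈ Φ.1 with hS_def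
    have hS : ∀ y, y ∈ S ↔ embOf φ₀ (e.symm y) ∈ Φ.1 := fun y => by
      simp only [hS_def, Finset.mem_filter, Finset.mem_univ, true_and]
    obtain ⟨v, hv1, hv⟩ := exists_leftStabiliser_of_not_isPrimitive e Φ φ₀ S hS hprim
    set c : K ≃ₐ[ℚ] K := (IsCMField.complexConj K).restrictScalars ℚ with hc_def
    have hc : e c = c := rfl
    have hScm := model_mul_mem_iff e hc Φ φ₀ S hS
    -- `c ∉ ⟨v⟩`: an element of `⟨v⟩` stabilises `S`, `c` moves it
    have hcv : c ∉ Subgroup.zpowers v := fun h =>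
      iff_not_self ((mem_iff_mul_mem_of_mem_zpowers S hv h 1).trans (hScm 1))
    have hcomm : ∀ g h : K ≃ₐ[ℚ] K, g * h = h * g := fun g h => by
      obtain ⟨γ, hγgen⟩ := hcyc.exists_generator
      obtain ⟨i, rfl⟩ := Subgroup.mem_zpowers_iff.1 (hγgen g)
      obtain ⟨j, rfl⟩ := Subgroup.mem_zpowers_iff.1 (hγgen h)
      rw [← zpow_add, ← zpow_add, add_comm]
    set H : Subgroup (K ≃ₐ[ℚ] K) := Subgroup.zpowers v with hH_def
    haveI hHn : H.Normal := ⟨fun x hx g => by rwa [hcomm g x, mul_inv_cancel_right]⟩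
    haveI : IsCMField (IntermediateField.fixedField H) := isCMField_fixedField_of_not_mem H hcv
    have hG : IsGalois ℚ (IntermediateField.fixedField H) := IsGalois.of_fixedField_normal_subgroup H
    haveI := hG
    -- `|⟨v⟩| = q`, `[K₀ : ℚ] = 2^{a+1}`
    have hcard : Fintype.card (K ≃ₐ[ℚ] K) = 2 ^ (a + 1) * q := by
      rw [← Nat.card_eq_fintype_card, IsGalois.card_aut_eq_finrank, hK]
    have hvq : orderOf v = q :=
      orderOf_eq_of_not_mem_zpowers hcyc hq hcard (model_complexConj_ne_one e hc) (model_complexConj_mul_self e hc)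
        hcv hv1
    have hdeg : Module.finrank ℚ (IntermediateField.fixedField H) = 2 ^ (a + 1) := by
      have h1 := FaceCensus.finrank_fixedField_mul_card H
      rw [hH_def, Nat.card_zpowers, hvq, hK] at h1
      exact Nat.eq_of_mul_eq_mul_right hq.pos h1
    have hcyc₀ : IsCyclic ((IntermediateField.fixedField H) ≃ₐ[ℚ] (IntermediateField.fixedField H)) :=
      isCyclic_of_surjective (AlgEquiv.restrictNormalHom (F := ℚ) (K₁ := K) ↥(IntermediateField.fixedField H))
        (AlgEquiv.restrictNormalHom_surjective (F := ℚ) (K₁ := ↥(IntermediateField.fixedField H)) (E := K))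
    obtain ⟨Φ₀, hΦ₀⟩ := exists_inducedCMType_fixedField_of_leftStabiliser e Φ φ₀ S hS hv H fun u hu => hu
    exact ⟨_, inferInstance, hG, Φ₀, hΦ₀, isNondegenerate_of_isCyclic hcyc₀ hdeg Φ₀, hdeg, hcyc₀⟩

/-! ## §3 Every abelian variety with a `K`-action is stably nondegenerate; the classification -/

omit [IsGalois ℚ K] in
/-- An odd number is not `2`. [folklore] -/
private theorem ne_two_of_odd {m : ℕ} (hm : Odd m) : m ≠ 2 := by
  obtain ⟨j, rfl⟩ := hm
  omega

/-- **THEOREM (ALL TYPES, cyclic).  Let `K` be a CM field, Galois over `ℚ` with CYCLIC Galois group of order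
`[K:ℚ] = 2^{a+1} m`, `m = 1` or `m` an odd prime.  Then EVERY complex abelian variety `X` with `φ : K →+* End⁰(X)` and
`[K:ℚ] = 2 dim X` — simple or not, of any CM type — is STABLY NONDEGENERATE** (`B = D` on all powers).  THE type of
`(X, φ)` is nondegenerate (`m = 1`: gen 11; primitive: gen 11) or induced from a nondegenerate type of `K^{C_m}` (§2);
both feed `EndFieldFullDegree.isStablyNondegenerate_of_isNondegenerate(_cmTypeOfPair)`. UNCONDITIONAL.
[cite: Shimura1998, §5.1 Prop. 3, §6.2 Thm. 3, §8.2 Prop. 26] [cite: Gordon1999HodgeAVSurvey, Thm. 6.4, Def. 7.6 and Prop. 9.4.1] -/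
theorem isStablyNondegenerate_of_ringHom_of_isCyclic (hcyc : IsCyclic (K ≃ₐ[ℚ] K)) {a m : ℕ} (hm : Odd m)
    (hgood : m = 1 ∨ m.Prime) (hK : Module.finrank ℚ K = 2 ^ (a + 1) * m) {X : AbelianVariety ℂ}
    (φ : K →+* X.endAlgebra) (hX : Module.finrank ℚ K = 2 * X.dim) : IsStablyNondegenerate X := by
  rcases hgood with rfl | hp
  · exact EndFieldFullDegree.isStablyNondegenerate_of_isNondegenerate_cmTypeOfPair φ hX
      (isNondegenerate_of_isCyclic hcyc (k := a) (by rw [hK, mul_one]) _)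
  · rcases isNondegenerate_or_exists_induced_of_isCyclic hcyc hp (ne_two_of_odd hm) hK (cmTypeOfPair φ hX) with
      h | ⟨K₀, hK₀, -, Φ₀, hΦ, hΦ₀, -, -⟩
    · exact EndFieldFullDegree.isStablyNondegenerate_of_isNondegenerate_cmTypeOfPair φ hX h
    · haveI := hK₀
      exact EndFieldFullDegree.isStablyNondegenerate_of_isNondegenerate φ hX hΦ hΦ₀

/-- **The Hodge conjecture for every power `X^{N+1}`** of such an `X`, UNCONDITIONALLY.
[cite: Gordon1999HodgeAVSurvey, Thm. 6.4 and Def. 7.6] -/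
theorem hodgeConjectureFor_powSucc_of_ringHom_of_isCyclic (hcyc : IsCyclic (K ≃ₐ[ℚ] K)) {a m : ℕ} (hm : Odd m)
    (hgood : m = 1 ∨ m.Prime) (hK : Module.finrank ℚ K = 2 ^ (a + 1) * m) {X : AbelianVariety ℂ}
    (φ : K →+* X.endAlgebra) (hX : Module.finrank ℚ K = 2 * X.dim) (N : ℕ) :
    HodgeConjectureFor (X.powSucc N).dim (X.powSucc N).X :=
  (isStablyNondegenerate_of_ringHom_of_isCyclic hcyc hm hgood hK φ hX).hodgeConjectureFor_powSucc N

/-- **The Hodge conjecture for everything isogenous to a power of such an `X`.** [cite: Gordon1999HodgeAVSurvey, Thm. 6.4]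
[cite: vanGeemen1994HodgeAV, Lemma 3.7] -/
theorem hodgeConjectureFor_of_isIsogenous_powSucc_of_isCyclic (hcyc : IsCyclic (K ≃ₐ[ℚ] K)) {a m : ℕ} (hm : Odd m)
    (hgood : m = 1 ∨ m.Prime) (hK : Module.finrank ℚ K = 2 ^ (a + 1) * m) {X : AbelianVariety ℂ}
    (φ : K →+* X.endAlgebra) (hX : Module.finrank ℚ K = 2 * X.dim) {B : AbelianVariety ℂ} {N : ℕ}
    (h : IsIsogenous B (X.powSucc N)) : HodgeConjectureFor B.dim B.X :=
  (isStablyNondegenerate_of_ringHom_of_isCyclic hcyc hm hgood hK φ hX).hodgeConjectureFor_of_isIsogenous_powSucc h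

variable {Φ : CMType K} {A : AbelianVariety ℂ} {ι : 𝓞 K →+* End A} {θ : K →+* Module.End ℂ (complexBetti A.X 1)}

/-- **Realisation form**: every abelian variety `(A, ι)` of ANY CM type `(K; Φ)` is stably nondegenerate.
[cite: Shimura1998, §5.1–5.2] [cite: Gordon1999HodgeAVSurvey, Thm. 6.4 and Prop. 9.4.1] -/
theorem isStablyNondegenerate_of_isCMTypeRealisation_of_isCyclic (hcyc : IsCyclic (K ≃ₐ[ℚ] K)) {a m : ℕ}
    (hm : Odd m) (hgood : m = 1 ∨ m.Prime) (hK : Module.finrank ℚ K = 2 ^ (a + 1) * m)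
    (hA : IsCMTypeRealisation Φ A ι θ) : IsStablyNondegenerate A := by
  obtain ⟨i, -⟩ := exists_ringHom_endAlgebra ι
  exact isStablyNondegenerate_of_ringHom_of_isCyclic hcyc hm hgood hK i (finrank_eq_two_mul_dim_of_isCMTypeRealisation hA)

/-- **THE HODGE CONJECTURE FOR EVERY POWER OF EVERY ABELIAN VARIETY WITH COMPLEX MULTIPLICATION BY A GALOIS CM FIELD WITH
CYCLIC GALOIS GROUP OF ORDER `2^{a+1} m`, `m = 1` or `m` an odd prime** — no simplicity or primitivity hypothesis;
UNCONDITIONAL. [cite: Gordon1999HodgeAVSurvey, Thm. 6.4 and Prop. 9.4.1] [cite: Shimura1998, §5.1 Prop. 3, §8.2 Prop. 26] -/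
theorem hodgeConjectureFor_pow_of_isCyclic_all (hcyc : IsCyclic (K ≃ₐ[ℚ] K)) {a m : ℕ} (hm : Odd m)
    (hgood : m = 1 ∨ m.Prime) (hK : Module.finrank ℚ K = 2 ^ (a + 1) * m) (hA : IsCMTypeRealisation Φ A ι θ)
    (N : ℕ) : HodgeConjectureFor (⨁ fun _ : Fin N => A).dim (⨁ fun _ : Fin N => A).X :=
  hodgeConjectureFor_of_isDivisorGenerated _
    ((isStablyNondegenerate_iff_forall_isDivisorGenerated_biproduct A).1
      (isStablyNondegenerate_of_isCMTypeRealisation_of_isCyclic hcyc hm hgood hK hA) N)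

/-- **THE CLASSIFICATION (all abelian varieties, cyclic Galois group).**  `K` CM, Galois over `ℚ` with cyclic group of
order `[K:ℚ] = 2^{a+1} m`, `m` odd: EVERY complex abelian variety `X` with a `K`-action on `End⁰` and
`[K:ℚ] = 2 dim X` is stably nondegenerate ⟺ `m = 1` or `m` is prime.  (⇒: for `m` composite gen 12 supplies a
primitive DEGENERATE type, realised — Shimura's existence theorem, tree `cmAbelianVarietyRealised_holds` — by an
abelian variety which is not stably nondegenerate by Hazama's criterion.)  Compare gen 12's
`forall_isPrimitive_isNondegenerate_iff_of_isCyclic` (simple varieties only). [cite: Gordon1999HodgeAVSurvey, Thm. 6.4]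
[cite: Dodson1984, §3.2.1] [cite: Shimura1998, §6.2 Thm. 3 and §8.2 Prop. 26] -/
theorem forall_isStablyNondegenerate_iff_of_isCyclic (hcyc : IsCyclic (K ≃ₐ[ℚ] K)) {a m : ℕ} (hm : Odd m)
    (hK : Module.finrank ℚ K = 2 ^ (a + 1) * m) :
    (∀ (X : AbelianVariety ℂ) (_ : K →+* X.endAlgebra), Module.finrank ℚ K = 2 * X.dim → IsStablyNondegenerate X) ↔
      (m = 1 ∨ m.Prime) := by
  refine ⟨fun h => ?_, fun hgood X φ hX => isStablyNondegenerate_of_ringHom_of_isCyclic hcyc hm hgood hK φ hX⟩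
  by_contra hnot
  rw [not_or] at hnot
  have h2m : 2 ≤ m := by
    obtain ⟨j, hj⟩ := hm
    omega
  obtain ⟨l, hlm, h2l, hl⟩ := (Nat.not_prime_iff_exists_dvd_lt h2m).1 hnot.2
  obtain ⟨Ψ, hprim, hdeg⟩ := exists_isPrimitive_not_isNondegenerate_of_isCyclic hcyc hm hlm h2l hl hK
  obtain ⟨B, ιB, θB, hB⟩ := exists_isCMTypeRealisation_of_realised cmAbelianVarietyRealised_holds K Ψ
  obtain ⟨i, -⟩ := exists_ringHom_endAlgebra ιB
  obtain ⟨φ₀⟩ := (inferInstance : Nonempty (K →+* ℂ))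
  exact hdeg ((isStablyNondegenerate_iff_isNondegenerate φ₀ (hprim φ₀) hB).1
    (h B i (finrank_eq_two_mul_dim_of_isCMTypeRealisation hB)))

/-- **The same in the realisation vocabulary.** [cite: Gordon1999HodgeAVSurvey, Thm. 6.4] [cite: Shimura1998, §8.2 Prop. 26] -/
theorem forall_realisation_isStablyNondegenerate_iff_of_isCyclic (hcyc : IsCyclic (K ≃ₐ[ℚ] K)) {a m : ℕ}
    (hm : Odd m) (hK : Module.finrank ℚ K = 2 ^ (a + 1) * m) :
    (∀ (Φ : CMType K) (A : AbelianVariety ℂ) (ι : 𝓞 K →+* End A) (θ : K →+* Module.End ℂ (complexBetti A.X 1)),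
        IsCMTypeRealisation Φ A ι θ → IsStablyNondegenerate A) ↔ (m = 1 ∨ m.Prime) := by
  refine ⟨fun h => ?_, fun hgood Φ A ι θ hA => isStablyNondegenerate_of_isCMTypeRealisation_of_isCyclic hcyc hm hgood hK hA⟩
  by_contra hnot
  rw [not_or] at hnot
  have h2m : 2 ≤ m := by
    obtain ⟨j, hj⟩ := hm
    omega
  obtain ⟨l, hlm, h2l, hl⟩ := (Nat.not_prime_iff_exists_dvd_lt h2m).1 hnot.2
  obtain ⟨Ψ, hprim, hdeg⟩ := exists_isPrimitive_not_isNondegenerate_of_isCyclic hcyc hm hlm h2l hl hK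
  obtain ⟨B, ιB, θB, hB⟩ := exists_isCMTypeRealisation_of_realised cmAbelianVarietyRealised_holds K Ψ
  obtain ⟨φ₀⟩ := (inferInstance : Nonempty (K →+* ℂ))
  exact hdeg ((isStablyNondegenerate_iff_isNondegenerate φ₀ (hprim φ₀) hB).1 (h Ψ B ιB θB hB))

end Field

/-! ## §4 `ℚ(ζ_p)`, `p − 1 = 2^{a+1} m`, `m ∈ {1} ∪ primes` -/

section Cyclotomic

variable {L : Type} [Field L] [NumberField L]

/-- `2 < p` for a prime `p` with `p - 1 = 2^{a+1} m`, `m ≥ 1`. [folklore] -/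
private theorem two_lt_of_prime {p a m : ℕ} (hp : p.Prime) (hm : 0 < m) (hpam : p - 1 = 2 ^ (a + 1) * m) :
    2 < p := by
  have h1 : 2 ≤ 2 ^ (a + 1) := by
    rw [pow_succ]; have := Nat.one_le_two_pow (n := a); omega
  have h2 : 2 ≤ 2 ^ (a + 1) * m := le_trans h1 (Nat.le_mul_of_pos_right _ hm)
  have := hp.two_le
  omega

/-- **`ℚ(ζ_p)`, `p − 1 = 2^{a+1} m` with `m = 1` or `m` an odd prime (`p = 5, 7, 11, 13, 17, 23, 29, 41, 47, 53, 59, 83,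
89, 97, 107, …`): EVERY complex abelian variety `X` of dimension `(p−1)/2` with `ℚ(ζ_p) ↪ End⁰(X)` is stably
nondegenerate** — the Hodge conjecture for all of them and all their powers, unconditionally, with no simplicity
hypothesis. [cite: Gordon1999HodgeAVSurvey, Thm. 6.4 and Prop. 9.4.1] [cite: Washington1997, Thm. 2.5] -/
theorem isStablyNondegenerate_of_ringHom_cyclotomic {p a m : ℕ} (hp : p.Prime) (hm : Odd m) (hgood : m = 1 ∨ m.Prime)
    (hpam : p - 1 = 2 ^ (a + 1) * m) [IsCyclotomicExtension {p} ℚ L] {X : AbelianVariety ℂ} (φ : L →+* X.endAlgebra)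
    (hX : Module.finrank ℚ L = 2 * X.dim) : IsStablyNondegenerate X := by
  obtain ⟨hcm, -, hcyc, hL⟩ := cm_normal_cyclic_finrank_of_prime hp (two_lt_of_prime hp hm.pos hpam) L
  haveI := hcm
  haveI : IsGalois ℚ L := IsCyclotomicExtension.isGalois {p} ℚ L
  exact isStablyNondegenerate_of_ringHom_of_isCyclic hcyc hm hgood (hL.trans hpam) φ hX

/-- HC for everything isogenous to a power of such an `X`. [cite: Gordon1999HodgeAVSurvey, Thm. 6.4] [cite: vanGeemen1994HodgeAV, Lemma 3.7] -/
theorem hodgeConjectureFor_of_isIsogenous_powSucc_cyclotomic {p a m : ℕ} (hp : p.Prime) (hm : Odd m)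
    (hgood : m = 1 ∨ m.Prime) (hpam : p - 1 = 2 ^ (a + 1) * m) [IsCyclotomicExtension {p} ℚ L] {X : AbelianVariety ℂ}
    (φ : L →+* X.endAlgebra) (hX : Module.finrank ℚ L = 2 * X.dim) {B : AbelianVariety ℂ} {N : ℕ}
    (h : IsIsogenous B (X.powSucc N)) : HodgeConjectureFor B.dim B.X :=
  (isStablyNondegenerate_of_ringHom_cyclotomic hp hm hgood hpam φ hX).hodgeConjectureFor_of_isIsogenous_powSucc h

/-- **`ℚ(ζ_p)`, `p − 1 = 2^{a+1} m`, `m` odd: all abelian varieties of dimension `(p−1)/2` with `ℚ(ζ_p) ↪ End⁰` are stably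
nondegenerate ⟺ `m = 1 ∨ m` prime** (`p = 5, 7, 11, 13, 17, 23, 29, 41, 47, 53, 59, …` versus
`p = 19, 31, 37, 43, 61, 67, 71, 73, 79, …`). [cite: Gordon1999HodgeAVSurvey, Thm. 6.4 and Prop. 9.4.2] [cite: Dodson1984, §3.2.1]
[cite: Washington1997, Thm. 2.5] -/
theorem forall_isStablyNondegenerate_iff_cyclotomic {p a m : ℕ} (hp : p.Prime) (hm : Odd m)
    (hpam : p - 1 = 2 ^ (a + 1) * m) [IsCyclotomicExtension {p} ℚ L] :
    (∀ (X : AbelianVariety ℂ) (_ : L →+* X.endAlgebra), Module.finrank ℚ L = 2 * X.dim → IsStablyNondegenerate X) ↔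
      (m = 1 ∨ m.Prime) := by
  obtain ⟨hcm, -, hcyc, hL⟩ := cm_normal_cyclic_finrank_of_prime hp (two_lt_of_prime hp hm.pos hpam) L
  haveI := hcm
  haveI : IsGalois ℚ L := IsCyclotomicExtension.isGalois {p} ℚ L
  exact forall_isStablyNondegenerate_iff_of_isCyclic hcyc hm (hL.trans hpam)

end Cyclotomic

end Summit.HodgeConjecture.CorCM.CyclicAllTypes

end
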